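import Summits.Ventures.CertifiedManyBodySolver.Theorems.TcThermcert1FreeGasEsymmInputs
import HarnessLib

/-!
# Free-gas (`U = 0`) sector witness for TcThermcert1's K1 family — part 6: off-arc Gaussian decay, fugacity pinning, and the ratio-to-log step

`Inputs.offArcGaussianDecay_holds : OffArcGaussianDecay` (one line per mode); fugacity pinning `(k+1) e_{k+1} ≤ (n−k)·max·e_k` and
`≥ (n−k)·min·e_k`, so the mode fugacity of degree `M` lies in `[M/((n−M+1)·max), (M+1)/((n−M)·min)]`
(`Inputs.exists_modeFugacity_pinned`); and the RATIO-TO-LOG step `Inputs.abs_log_esymmW_sub_le` (two weight families whose twisted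
generating polynomials are pointwise close on the mode circle have close `log e_M`).
HONEST FRAMING: statements about the FREE (`U = 0`) twisted torus gas and about symmetric functions of explicit reals;
nothing here touches `U = 8`; superconductivity in the Hubbard model is NOT proved (or disproved) by any of this.
Provenance: landed form of the crux workfile `Cruxes/ThermalStiffnessCeilingU8b10_le_1o8/FreeGasArcSkeleton.lean` v4.1 (tree 80a90c42bbb7)
+ `FreeGasArcInputs.lean` (d3c3c585d14e), planner `hubbard-floor-idea-rescuer` g5, card `free-gas-arc-darroch` (crit-1 KEEP);
hubbard-floor support target ST-K1-U0-1, `--supports stmt-Ventures-26381` (TcThermcert1 crux K1). Split into ≤ 400-line modules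
`Theorems/TcThermcert1FreeGas*.lean`.
-/

noncomputable section

namespace Summit.Ventures.CertifiedManyBodySolver.Theorems.FreeGasArc.Inputs

open Finset Real MeasureTheory
open Literature.Geometry.Riemannian (esymm_zero_eq_one esymm_card_eq_prod esymm_nonneg_of_forall_nonneg
  esymm_eq_zero_of_card_lt esymm_cons_succ)
open scoped BigOperators

/-! ## §E The off-arc Gaussian decay (the skeleton's `OffArcGaussianDecay`, verbatim) -/

/-- One mode: `|1 + u e^{iφ}|² = (1+u)² − 2u(1 − cos φ)` for real `u, φ`. -/
theorem normSq_one_add_mul_exp (u φ : ℝ) :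
    ‖(1 : ℂ) + (u : ℂ) * Complex.exp (Complex.I * φ)‖ ^ 2 = (1 + u) ^ 2 - 2 * u * (1 - Real.cos φ) := by
  have hre : ((1 : ℂ) + (u : ℂ) * Complex.exp (Complex.I * φ)).re = 1 + u * Real.cos φ := by
    simp [Complex.exp_re, Complex.exp_im]
  have him : ((1 : ℂ) + (u : ℂ) * Complex.exp (Complex.I * φ)).im = u * Real.sin φ := by
    simp [Complex.exp_re, Complex.exp_im]
  rw [← Complex.normSq_eq_norm_sq, Complex.normSq_apply, hre, him]
  have h := Real.sin_sq_add_cos_sq φ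
  linear_combination u ^ 2 * h

/-- One mode: `|1 + u e^{iφ}| ≤ (1+u) · exp(−(1 − cos φ) u/(1+u)²)` for `u ≥ 0` (from `1 − y ≤ e^{−y}`). -/
theorem norm_one_add_mul_exp_le (u φ : ℝ) (hu : 0 ≤ u) :
    ‖(1 : ℂ) + (u : ℂ) * Complex.exp (Complex.I * φ)‖ ≤
      (1 + u) * Real.exp (-((1 - Real.cos φ) * (u / (1 + u) ^ 2))) := by
  have h1u : 0 < 1 + u := by linarith
  set y : ℝ := (1 - Real.cos φ) * (u / (1 + u) ^ 2) with hy
  have hsq := normSq_one_add_mul_exp u φ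
  have hkey : ‖(1 : ℂ) + (u : ℂ) * Complex.exp (Complex.I * φ)‖ ^ 2 ≤ ((1 + u) * Real.exp (-y)) ^ 2 := by
    rw [hsq, mul_pow, ← Real.exp_nat_mul]
    have hexp : -(2 * y) + 1 ≤ Real.exp (-(2 * y)) := Real.add_one_le_exp _
    have e2 : ((2 : ℕ) : ℝ) * -y = -(2 * y) := by push_cast; ring
    rw [e2]
    have hid : (1 + u) ^ 2 * (-(2 * y) + 1) = (1 + u) ^ 2 - 2 * u * (1 - Real.cos φ) := by
      rw [hy]
      field_simp
      ring
    calc (1 + u) ^ 2 - 2 * u * (1 - Real.cos φ) = (1 + u) ^ 2 * (-(2 * y) + 1) := hid.symm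
      _ ≤ (1 + u) ^ 2 * Real.exp (-(2 * y)) := mul_le_mul_of_nonneg_left hexp (by positivity)
  exact le_of_pow_le_pow_left₀ two_ne_zero (by positivity) hkey

/-- [skeleton §3, verbatim] Off the arc the twisted product is Gaussian-small relative to the untwisted one. -/
def OffArcGaussianDecay : Prop :=
  ∀ (ι : Type) [Fintype ι] (u : ι → ℝ) (φ : ℝ), (∀ i, 0 < u i) →
    ‖∏ i, ((1 : ℂ) + (u i : ℂ) * Complex.exp (Complex.I * φ))‖ ≤
      (∏ i, (1 + u i)) * Real.exp (-((1 - Real.cos φ) * ∑ i, u i / (1 + u i) ^ 2))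

/-- **The off-arc input holds.** -/
theorem offArcGaussianDecay_holds : OffArcGaussianDecay := by
  intro ι _ u φ hu
  calc ‖∏ i, ((1 : ℂ) + (u i : ℂ) * Complex.exp (Complex.I * φ))‖
      = ∏ i, ‖(1 : ℂ) + (u i : ℂ) * Complex.exp (Complex.I * φ)‖ := norm_prod _ _
    _ ≤ ∏ i, ((1 + u i) * Real.exp (-((1 - Real.cos φ) * (u i / (1 + u i) ^ 2)))) :=
        Finset.prod_le_prod (fun i _ => norm_nonneg _) (fun i _ => norm_one_add_mul_exp_le (u i) φ (hu i).le)
    _ = (∏ i, (1 + u i)) * Real.exp (-((1 - Real.cos φ) * ∑ i, u i / (1 + u i) ^ 2)) := by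
        rw [Finset.prod_mul_distrib, ← Real.exp_sum, Finset.mul_sum, ← Finset.sum_neg_distrib]

/-! ## §F Fugacity pinning: ratio bounds `(n−k)·min·e_k ≤ (k+1)·e_{k+1} ≤ (n−k)·max·e_k` -/

/-- Upper ratio bound: if every weight is `≤ B`, then `(k+1) e_{k+1}(X) ≤ (|X| − k) B e_k(X)` (all `k`; for
`k ≥ |X|` both sides vanish or the right side is `≤ 0 = ` left side). -/
theorem succ_mul_esymm_succ_le (X : Multiset ℝ) {B : ℝ} (hX : ∀ a ∈ X, 0 ≤ a) (hB : ∀ a ∈ X, a ≤ B) :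
    ∀ k : ℕ, ((k : ℝ) + 1) * X.esymm (k + 1) ≤ ((Multiset.card X : ℝ) - k) * B * X.esymm k := by
  induction X using Multiset.induction with
  | empty =>
    intro k
    rw [esymm_eq_zero_of_card_lt 0 (by simp)]
    rcases Nat.eq_zero_or_pos k with rfl | hk
    · simp [esymm_zero_eq_one]
    · rw [esymm_eq_zero_of_card_lt 0 (by simpa using hk)]
      simp
  | cons x X ih =>
    intro k
    have hx : 0 ≤ x := hX x (Multiset.mem_cons_self x X)
    have hxB : x ≤ B := hB x (Multiset.mem_cons_self x X)
    have hX' : ∀ a ∈ X, 0 ≤ a := fun a ha => hX a (Multiset.mem_cons_of_mem ha)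
    have hB' : ∀ a ∈ X, a ≤ B := fun a ha => hB a (Multiset.mem_cons_of_mem ha)
    have hB0 : 0 ≤ B := hx.trans hxB
    rw [Multiset.card_cons, esymm_cons_succ]
    push_cast
    rcases k with _ | k
    · -- `k = 0`: `e_1(x ∷ X) = e_1(X) + x ≤ (n+1) B`
      have h := ih hX' hB' 0
      simp only [zero_add, one_mul, sub_zero, CharP.cast_eq_zero] at h ⊢
      rw [esymm_zero_eq_one] at h
      rw [esymm_zero_eq_one, esymm_zero_eq_one]
      nlinarith [h]
    · rw [esymm_cons_succ]
      have h1 := ih hX' hB' (k + 1)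
      have h0 := ih hX' hB' k
      have hek : 0 ≤ X.esymm k := esymm_nonneg_of_forall_nonneg X hX' k
      have hek1 : 0 ≤ X.esymm (k + 1) := esymm_nonneg_of_forall_nonneg X hX' (k + 1)
      push_cast at h1 h0 ⊢
      -- `(k+2) (e_{k+2} + x e_{k+1}) ≤ (n+1-(k+1)) B (e_{k+1} + x e_k)`:
      -- `(k+2) e_{k+2} ≤ (n-k-1) B e_{k+1}` (h1), `x (k+2) e_{k+1} = x[(k+1) e_{k+1} + e_{k+1}] ≤ x (n-k) B e_k + x e_{k+1}`
      -- (h0), and `x e_{k+1} ≤ B e_{k+1}`.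
      nlinarith [mul_le_mul_of_nonneg_left h0 hx, mul_le_mul_of_nonneg_right hxB hek1]

/-- Lower ratio bound: if every weight is `≥ b` (`b ≥ 0`), then `(|X| − k) b e_k(X) ≤ (k+1) e_{k+1}(X)`. -/
theorem sub_mul_esymm_le_succ_mul_esymm_succ (X : Multiset ℝ) {b : ℝ} (hb : 0 ≤ b) (hX : ∀ a ∈ X, b ≤ a) :
    ∀ k : ℕ, ((Multiset.card X : ℝ) - k) * b * X.esymm k ≤ ((k : ℝ) + 1) * X.esymm (k + 1) := by
  induction X using Multiset.induction with
  | empty =>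
    intro k
    rw [esymm_eq_zero_of_card_lt 0 (by simp : Multiset.card (0 : Multiset ℝ) < k + 1)]
    rcases Nat.eq_zero_or_pos k with rfl | hk
    · simp [esymm_zero_eq_one]
    · rw [esymm_eq_zero_of_card_lt 0 (by simpa using hk)]
      simp
  | cons x X ih =>
    intro k
    have hxb : b ≤ x := hX x (Multiset.mem_cons_self x X)
    have hx : 0 ≤ x := hb.trans hxb
    have hX' : ∀ a ∈ X, b ≤ a := fun a ha => hX a (Multiset.mem_cons_of_mem ha)
    have hX0' : ∀ a ∈ X, 0 ≤ a := fun a ha => hb.trans (hX' a ha)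
    have ih' := ih hX'
    rw [Multiset.card_cons, esymm_cons_succ]
    push_cast
    rcases k with _ | k
    · have h := ih' 0
      simp only [zero_add, one_mul, sub_zero, CharP.cast_eq_zero] at h ⊢
      rw [esymm_zero_eq_one] at h
      rw [esymm_zero_eq_one, esymm_zero_eq_one]
      nlinarith [h]
    · rw [esymm_cons_succ]
      have h1 := ih' (k + 1)
      have h0 := ih' k
      have hek : 0 ≤ X.esymm k := esymm_nonneg_of_forall_nonneg X hX0' k
      have hek1 : 0 ≤ X.esymm (k + 1) := esymm_nonneg_of_forall_nonneg X hX0' (k + 1)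
      push_cast at h1 h0 ⊢
      nlinarith [mul_le_mul_of_nonneg_left h0 hx, mul_le_mul_of_nonneg_right hxb hek1]

/-- **Fugacity pinning at a mode.** If `t > 0` makes `M` the mode of `j ↦ e_j(X) t^j` (positive weights in
`[b, B]`, `M < |X|`), then `(|X| − M)·b·t ≤ M + 1` and, if moreover `1 ≤ M`, `M ≤ (|X| − M + 1)·B·t`:
the fugacity is comparable to `M / (|X| − M)` within the factor `B/b` — for Boltzmann weights `e^{−βξ}`,
`|ξ| ≤ 4`, the chemical potential `β⁻¹ log t` lies in `[−4 − O(β⁻¹), 4 + O(β⁻¹)]` at any fixed filling fraction. -/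
theorem modeFugacity_pinned (X : Multiset ℝ) {b B t : ℝ} {M : ℕ} (hb : 0 < b) (hXb : ∀ a ∈ X, b ≤ a)
    (hXB : ∀ a ∈ X, a ≤ B) (ht : 0 < t) (hM : M < Multiset.card X)
    (hmode : ∀ j, X.esymm j * t ^ j ≤ X.esymm M * t ^ M) :
    ((Multiset.card X : ℝ) - M) * b * t ≤ (M : ℝ) + 1 ∧
      (1 ≤ M → (M : ℝ) ≤ ((Multiset.card X : ℝ) - M + 1) * B * t) := by
  have hX0 : ∀ a ∈ X, 0 ≤ a := fun a ha => hb.le.trans (hXb a ha)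
  have hXpos : ∀ a ∈ X, 0 < a := fun a ha => hb.trans_le (hXb a ha)
  have heM : 0 < X.esymm M := esymm_pos X hXpos hM.le
  constructor
  · -- from `e_{M+1} t^{M+1} ≤ e_M t^M`, i.e. `t e_{M+1} ≤ e_M`, and `(n−M) b e_M ≤ (M+1) e_{M+1}`
    have h1 := hmode (M + 1)
    rw [pow_succ] at h1
    have h1' : X.esymm (M + 1) * t ≤ X.esymm M := by
      have := h1
      have htM : 0 < t ^ M := pow_pos ht M
      nlinarith [this]
    have h2 := sub_mul_esymm_le_succ_mul_esymm_succ X hb.le hXb M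
    -- `(n−M) b t e_M ≤ (M+1) t e_{M+1} ≤ (M+1) e_M`
    have h3 : ((Multiset.card X : ℝ) - M) * b * t * X.esymm M ≤ ((M : ℝ) + 1) * X.esymm M := by
      nlinarith [mul_le_mul_of_nonneg_left h2 ht.le, mul_le_mul_of_nonneg_left h1' (by positivity : (0:ℝ) ≤ (M:ℝ) + 1)]
    exact le_of_mul_le_mul_right h3 heM
  · intro hM1
    -- from `e_{M−1} t^{M−1} ≤ e_M t^M`, i.e. `e_{M−1} ≤ t e_M`, and `M e_M ≤ (n−M+1) B e_{M−1}`
    obtain ⟨M', rfl⟩ : ∃ M', M = M' + 1 := ⟨M - 1, by omega⟩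
    have h1 := hmode M'
    rw [pow_succ] at h1
    have h1' : X.esymm M' ≤ X.esymm (M' + 1) * t := by
      have htM : 0 < t ^ M' := pow_pos ht M'
      nlinarith [h1]
    have h2 := succ_mul_esymm_succ_le X hX0 hXB M'
    have hB0 : 0 ≤ B := by
      obtain ⟨a, ha⟩ := Multiset.card_pos_iff_exists_mem.mp (by omega : 0 < Multiset.card X)
      exact (hX0 a ha).trans (hXB a ha)
    push_cast
    have hnM : (0:ℝ) ≤ (Multiset.card X : ℝ) - M' := by
      have : (M' : ℝ) + 1 < Multiset.card X := by exact_mod_cast hM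
      linarith
    have h3 : ((M' : ℝ) + 1) * X.esymm (M' + 1) ≤ ((Multiset.card X : ℝ) - (M' + 1) + 1) * B * t * X.esymm (M' + 1) := by
      have h4 := mul_le_mul_of_nonneg_left h1' (mul_nonneg hnM hB0)
      have hcast : ((Multiset.card X : ℝ) - (M' + 1) + 1) = (Multiset.card X : ℝ) - M' := by ring
      rw [hcast]
      nlinarith [h2, h4]
    exact le_of_mul_le_mul_right h3 heM

/-! ## §I Pinned mode fugacity in `Fintype` form and the RATIO-TO-LOG step -/

/-- **Pinned mode fugacity, `Fintype` form.**  For weights `b ≤ xᵢ ≤ B` (`b > 0`) and `1 ≤ M < |ι|` there is a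
fugacity `t > 0` at which `M` is a mode of `j ↦ e_j(x) t^j`, with the polynomial floor and the two pinning
inequalities `(|ι| − M) b t ≤ M + 1`, `M ≤ (|ι| − M + 1) B t`. -/
theorem exists_modeFugacity_pinned {ι : Type} [Fintype ι] [DecidableEq ι] (x : ι → ℝ) {b B : ℝ} (hb : 0 < b)
    (hxb : ∀ i, b ≤ x i) (hxB : ∀ i, x i ≤ B) {M : ℕ} (hM1 : 1 ≤ M) (hM : M < Fintype.card ι) :
    ∃ t : ℝ, 0 < t ∧ (∀ j : ℕ, esymmW x j * t ^ j ≤ esymmW x M * t ^ M) ∧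
      (∏ i, (1 + t * x i)) ≤ ((Fintype.card ι : ℝ) + 1) * (esymmW x M * t ^ M) ∧
      ((Fintype.card ι : ℝ) - M) * b * t ≤ (M : ℝ) + 1 ∧ (M : ℝ) ≤ ((Fintype.card ι : ℝ) - M + 1) * B * t := by
  set X : Multiset ℝ := (Finset.univ : Finset ι).val.map x with hXdef
  have hcard : Multiset.card X = Fintype.card ι := by
    rw [hXdef, Multiset.card_map]
    rfl
  have hmem : ∀ a ∈ X, ∃ i, x i = a := by
    intro a ha
    rw [hXdef, Multiset.mem_map] at ha
    obtain ⟨i, _, rfl⟩ := ha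
    exact ⟨i, rfl⟩
  have hXpos : ∀ a ∈ X, 0 < a := fun a ha => by obtain ⟨i, rfl⟩ := hmem a ha; exact hb.trans_le (hxb i)
  have hXb : ∀ a ∈ X, b ≤ a := fun a ha => by obtain ⟨i, rfl⟩ := hmem a ha; exact hxb i
  have hXB : ∀ a ∈ X, a ≤ B := fun a ha => by obtain ⟨i, rfl⟩ := hmem a ha; exact hxB i
  obtain ⟨t, ht, hmode⟩ := esymm_exists_modeFugacity X hXpos (M := M) (by rw [hcard]; exact hM.le)
  have hpin := modeFugacity_pinned X hb hXb hXB ht (by rw [hcard]; exact hM) hmode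
  rw [hcard] at hpin
  refine ⟨t, ht, ?_, ?_, hpin.1, hpin.2 hM1⟩
  · intro j
    rw [esymmW_eq_esymm, esymmW_eq_esymm]
    exact hmode j
  · rw [esymmW_eq_esymm, ← hcard]
    have hprod : (∏ i, (1 + t * x i)) = (X.map fun a => 1 + t * a).prod := by
      rw [hXdef, Multiset.map_map, Function.comp_def]
      exact (Finset.prod_map_val Finset.univ (fun i => 1 + t * x i)).symm
    rw [hprod]
    exact prod_one_add_mul_le_of_mode X hmode

/-- **The ratio-to-log step (generic).**  If at a fugacity `t` where `M` is a mode for the weights `y` the two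
generating products `∏ᵢ(1 + t xᵢ e^{iφ})`, `∏ᵢ(1 + t yᵢ e^{iφ})` differ by at most `K · ∏ᵢ(1 + t yᵢ)` on the whole
circle, and `(|ι| + 1) K ≤ 1/2`, then `|log e_M(y) − log e_M(x)| ≤ 2 (|ι| + 1) K`.  (Contour formula
`esymmW_fourierCoeff` + polynomial floor.) -/
theorem abs_log_esymmW_sub_le {ι : Type} [Fintype ι] [DecidableEq ι] (x y : ι → ℝ)
    (hx : ∀ i, 0 < x i) (hy : ∀ i, 0 < y i) {t : ℝ} (ht : 0 < t) {M : ℕ} (hM : M ≤ Fintype.card ι)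
    (hmode : ∀ j : ℕ, esymmW y j * t ^ j ≤ esymmW y M * t ^ M) {K : ℝ} (hK : 0 ≤ K)
    (hpt : ∀ φ : ℝ, φ ∈ Set.uIoc (-π) π →
      ‖∏ i, ((1 : ℂ) + ((t * x i : ℝ) : ℂ) * Complex.exp (φ * Complex.I)) -
          ∏ i, ((1 : ℂ) + ((t * y i : ℝ) : ℂ) * Complex.exp (φ * Complex.I))‖ ≤ (∏ i, (1 + t * y i)) * K)
    (hsmall : ((Fintype.card ι : ℝ) + 1) * K ≤ 1 / 2) :
    |Real.log (esymmW y M) - Real.log (esymmW x M)| ≤ 2 * (((Fintype.card ι : ℝ) + 1) * K) := by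
  set η : ℝ := ((Fintype.card ι : ℝ) + 1) * K with hη
  have hη0 : 0 ≤ η := by positivity
  -- Step 1: `|e_M(x) − e_M(y)| t^M ≤ Π_y K` from the contour formula
  have hdiff : |esymmW x M * t ^ M - esymmW y M * t ^ M| ≤ (∏ i, (1 + t * y i)) * K := by
    have hX := esymmW_fourierCoeff x t M
    have hY := esymmW_fourierCoeff y t M
    have hix : IntervalIntegrable (fun φ : ℝ => Complex.exp (-((M : ℂ) * φ * Complex.I)) *
        ∏ i, ((1 : ℂ) + ((t * x i : ℝ) : ℂ) * Complex.exp (φ * Complex.I))) MeasureTheory.volume (-π) π :=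
      Continuous.intervalIntegrable (by fun_prop) _ _
    have hiy : IntervalIntegrable (fun φ : ℝ => Complex.exp (-((M : ℂ) * φ * Complex.I)) *
        ∏ i, ((1 : ℂ) + ((t * y i : ℝ) : ℂ) * Complex.exp (φ * Complex.I))) MeasureTheory.volume (-π) π :=
      Continuous.intervalIntegrable (by fun_prop) _ _
    have hint : ∫ φ in (-π)..π, Complex.exp (-((M : ℂ) * φ * Complex.I)) *
        (∏ i, ((1 : ℂ) + ((t * x i : ℝ) : ℂ) * Complex.exp (φ * Complex.I)) -
          ∏ i, ((1 : ℂ) + ((t * y i : ℝ) : ℂ) * Complex.exp (φ * Complex.I)))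
        = ((2 * π * (esymmW x M * t ^ M - esymmW y M * t ^ M) : ℝ) : ℂ) := by
      simp_rw [mul_sub]
      rw [intervalIntegral.integral_sub hix hiy, hX, hY]
      push_cast
      ring
    have hbound : ∀ φ ∈ Set.uIoc (-π) π, ‖Complex.exp (-((M : ℂ) * φ * Complex.I)) *
        (∏ i, ((1 : ℂ) + ((t * x i : ℝ) : ℂ) * Complex.exp (φ * Complex.I)) -
          ∏ i, ((1 : ℂ) + ((t * y i : ℝ) : ℂ) * Complex.exp (φ * Complex.I)))‖ ≤ (∏ i, (1 + t * y i)) * K := by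
      intro φ hφ
      have he : Complex.exp (-((M : ℂ) * φ * Complex.I)) = Complex.exp (((-((M : ℝ) * φ) : ℝ) : ℂ) * Complex.I) := by
        push_cast
        ring_nf
      rw [norm_mul, he, Complex.norm_exp_ofReal_mul_I, one_mul]
      exact hpt φ hφ
    have hnorm := intervalIntegral.norm_integral_le_of_norm_le_const hbound
    rw [hint, Complex.norm_real, Real.norm_eq_abs, abs_mul, abs_of_pos (by positivity : (0:ℝ) < 2 * π),
      show |π - -π| = 2 * π by rw [sub_neg_eq_add, ← two_mul, abs_of_pos (by positivity)]] at hnorm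
    have hP : 0 ≤ (∏ i, (1 + t * y i)) * K :=
      mul_nonneg (Finset.prod_nonneg fun i _ => by have := hy i; positivity) hK
    nlinarith [Real.pi_pos, hnorm, hP]
  -- Step 2: the polynomial floor `Π_y ≤ (n+1) e_M(y) t^M`
  set X : Multiset ℝ := (Finset.univ : Finset ι).val.map y with hXdef
  have hcard : Multiset.card X = Fintype.card ι := by
    rw [hXdef, Multiset.card_map]
    rfl
  have hfloor : (∏ i, (1 + t * y i)) ≤ ((Fintype.card ι : ℝ) + 1) * (esymmW y M * t ^ M) := by
    rw [esymmW_eq_esymm, ← hcard]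
    have hprod : (∏ i, (1 + t * y i)) = (X.map fun a => 1 + t * a).prod := by
      rw [hXdef, Multiset.map_map, Function.comp_def]
      exact (Finset.prod_map_val Finset.univ (fun i => 1 + t * y i)).symm
    rw [hprod]
    refine prod_one_add_mul_le_of_mode X fun j => ?_
    have := hmode j
    rwa [esymmW_eq_esymm, esymmW_eq_esymm] at this
  -- Step 3: positivity of `e_M` and the ratio bound
  have hposX : ∀ (z : ι → ℝ), (∀ i, 0 < z i) → 0 < esymmW z M := by
    intro z hz
    rw [esymmW_eq_esymm]
    refine esymm_pos _ (fun a ha => ?_) ?_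
    · rw [Multiset.mem_map] at ha
      obtain ⟨i, _, rfl⟩ := ha
      exact hz i
    · rw [Multiset.card_map]
      exact hM
  have heY : 0 < esymmW y M := hposX y hy
  have heX : 0 < esymmW x M := hposX x hx
  have htM : 0 < t ^ M := pow_pos ht M
  have hratio : |esymmW x M - esymmW y M| ≤ η * esymmW y M := by
    have h1 : |esymmW x M - esymmW y M| * t ^ M ≤ η * esymmW y M * t ^ M := by
      calc |esymmW x M - esymmW y M| * t ^ M = |esymmW x M * t ^ M - esymmW y M * t ^ M| := by
            rw [← sub_mul, abs_mul, abs_of_pos htM]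
        _ ≤ (∏ i, (1 + t * y i)) * K := hdiff
        _ ≤ ((Fintype.card ι : ℝ) + 1) * (esymmW y M * t ^ M) * K := mul_le_mul_of_nonneg_right hfloor hK
        _ = η * esymmW y M * t ^ M := by rw [hη]; ring
    exact le_of_mul_le_mul_right h1 htM
  -- Step 4: logarithms: `ρ = e_M(x)/e_M(y) ∈ [1 − η, 1 + η]`, `η ≤ 1/2`
  have hρ : 0 < esymmW x M / esymmW y M := div_pos heX heY
  have hρ1 : |esymmW x M / esymmW y M - 1| ≤ η := by
    rw [show esymmW x M / esymmW y M - 1 = (esymmW x M - esymmW y M) / esymmW y M by field_simp,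
      abs_div, abs_of_pos heY, div_le_iff₀ heY]
    exact hratio
  obtain ⟨hρl, hρu⟩ := abs_le.1 hρ1
  rw [abs_sub_comm, ← Real.log_div heX.ne' heY.ne', abs_le]
  constructor
  · -- lower: `log ρ ≥ 1 − ρ⁻¹ ≥ −2η`
    have hinv : Real.log (esymmW x M / esymmW y M)⁻¹ ≤ (esymmW x M / esymmW y M)⁻¹ - 1 :=
      Real.log_le_sub_one_of_pos (inv_pos.2 hρ)
    rw [Real.log_inv] at hinv
    have hinv2 : (esymmW x M / esymmW y M)⁻¹ ≤ 1 + 2 * η := by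
      rw [inv_le_comm₀ hρ (by positivity), inv_eq_one_div, div_le_iff₀ (by positivity : (0:ℝ) < 1 + 2 * η)]
      nlinarith [hρl, hsmall, hη0]
    linarith
  · have h1 : Real.log (esymmW x M / esymmW y M) ≤ esymmW x M / esymmW y M - 1 := Real.log_le_sub_one_of_pos hρ
    linarith

end Summit.Ventures.CertifiedManyBodySolver.Theorems.FreeGasArc.Inputs

end
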